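import Literature.Barriers.QuantumFields.HoppingExpansionUniformGap
import Literature.MathematicalPhysics.QuantumLattice.HubbardHighTemperatureTwoPoint
import Literature.MathematicalPhysics.QuantumLattice.LatticeToriProofs
import Mathlib.Analysis.CStarAlgebra.Matrix
import Mathlib.Analysis.Normed.Algebra.MatrixExponential
import Mathlib.Analysis.SpecialFunctions.Exponential
import HarnessLib

/-!
# Locality of the exponential of a finite-range (hopping) matrix

Topic `MathematicalPhysics/QuantumLattice`; a generic locality estimate used for the
imaginary-time evolution `e^{-τh}` of a finite-range one-body Hamiltonian `h` on a lattice
(programme under the tree's fact `bgm_two_point_limit`: the finite-temperature free propagators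
`e^{-τh}(1+e^{±βh})⁻¹` of BGM 2006 (1.4) are built from it, and bounds uniform in the volume need
the decay of its matrix entries uniformly in the size of the torus). For a **hopping matrix** `M`
in the sense of `Literature.Barriers.QuantumFields.HoppingExpansion.IsHoppingMatrix` (re-used, not
re-declared: `M i j ≠ 0 ⇒ dist i j ≤ 1` for a distance-like `dist`, and `ℓ¹` row sums `≤ h`):

* `IsHoppingMatrix.norm_pow_apply_le` — `‖(M^l) i j‖ ≤ h^l` (this and the next three are
  declared as dot-notation extensions `_root_.Literature.Barriers.QuantumFields.HoppingExpansion.IsHoppingMatrix.…`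
  of the re-used structure; the generic helpers `expTerm_apply`, `hasSum_shifted_expMajorant`,
  `pow_div_factorial_le_mul` live in this file's namespace);
* `IsHoppingMatrix.norm_expTerm_apply_le`, `IsHoppingMatrix.expTerm_apply_eq_zero` — the `n`-th term of the exponential series of
  `s • M` has `(i,j)` entry of norm `≤ (‖s‖h)ⁿ/n!`, and `= 0` for `n < dist i j` (no path of
  length `< dist i j` joins `i` to `j`);
* **`IsHoppingMatrix.norm_exp_smul_apply_le`** — `‖(e^{sM}) i j‖ ≤ e^{‖s‖h} (‖s‖h)^{dist i j}/(dist i j)!`: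
  super-exponential decay of the entries of the matrix exponential in the distance, with
  constants depending only on `‖s‖h` — for the Hubbard torus, uniform in the side `L`
  (the power-series/"sum over paths" argument; cf. the Lieb–Robinson bounds for the real-time
  evolution, Hastings–Koma 2006, and the Combes–Thomas method).

and the Hubbard torus instance: `orbTorusDist` (the periodic `ℓ^∞` distance of the sites of two
orbitals), `isHoppingMatrix_hubbardOneBody_torus` — the one-body matrix `h_L` of
`hubbardTorusWith d L t U μ` is a hopping matrix for `orbTorusDist` with row-sum bound
`2d|t| + |μ|`, the SAME for every side `L` — and **`norm_exp_smul_hubbardOneBody_torus_apply_le`**: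
`|[e^{s h_L}]_{(z,σ),(z',σ')}| ≤ e^{‖s‖K} (‖s‖K)^{dist(z,z')}/dist(z,z')!`, `K = 2d|t| + |μ|`, uniformly in `L`.
Everything is PROVED; the only definition is `orbTorusDist`.

## References

* O. Bratteli, D. W. Robinson, *Operator Algebras and Quantum Statistical Mechanics II*, 2nd ed.
  (Springer 1997), §6.2.1 (power-series locality of lattice dynamics). [BratteliRobinsonII1997]
* G. Benfatto, A. Giuliani, V. Mastropietro, Ann. Henri Poincaré 7 (2006) 809–898, §1.2 (1.4).
  [BenfattoGiulianiMastropietro2006]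
-/

noncomputable section

open scoped Matrix.Norms.L2Operator Nat
open Finset NormedSpace

namespace Literature.MathematicalPhysics.QuantumLattice

open Literature.Barriers.QuantumFields.HoppingExpansion

section Generic

variable {ι : Type*} [Fintype ι] [DecidableEq ι] {dist : ι → ι → ℕ} {M : Matrix ι ι ℂ} {h : ℝ}

/-- **Entries of powers of a hopping matrix**: `‖(M^l) i j‖ ≤ h^l` (one term of the row sum
`Σ_j ‖(M^l) i j‖ ≤ h^l`). [folklore] -/
theorem _root_.Literature.Barriers.QuantumFields.HoppingExpansion.IsHoppingMatrix.norm_pow_apply_le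
    (hM : IsHoppingMatrix dist M h) (l : ℕ) (i j : ι) :
    ‖(M ^ l) i j‖ ≤ h ^ l :=
  (Finset.single_le_sum (f := fun j => ‖(M ^ l) i j‖) (fun _ _ => norm_nonneg _)
    (Finset.mem_univ j)).trans (hM.rowSum_pow_le l i)

/-- The `(i,j)` entry of the `n`-th term of the exponential series of `s • M`. [folklore] -/
theorem expTerm_apply (s : ℂ) (n : ℕ) (i j : ι) :
    (((n !⁻¹ : ℂ)) • (s • M) ^ n) i j = (n !⁻¹ : ℂ) * s ^ n * (M ^ n) i j := by
  rw [smul_pow, Matrix.smul_apply, Matrix.smul_apply, smul_eq_mul, smul_eq_mul, mul_assoc]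

/-- **No path shorter than the distance**: the `n`-th exponential term vanishes at `(i,j)` for
`n < dist i j`. [folklore] -/
theorem _root_.Literature.Barriers.QuantumFields.HoppingExpansion.IsHoppingMatrix.expTerm_apply_eq_zero
    (hM : IsHoppingMatrix dist M h) (s : ℂ) {n : ℕ} {i j : ι}
    (hn : n < dist i j) : (((n !⁻¹ : ℂ)) • (s • M) ^ n) i j = 0 := by
  rw [expTerm_apply, hM.pow_apply_eq_zero hn, mul_zero]

/-- **Size of the exponential terms**: `‖(sⁿ Mⁿ/n!) i j‖ ≤ (‖s‖h)ⁿ/n!`. [folklore] -/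
theorem _root_.Literature.Barriers.QuantumFields.HoppingExpansion.IsHoppingMatrix.norm_expTerm_apply_le
    (hM : IsHoppingMatrix dist M h) (s : ℂ) (n : ℕ) (i j : ι) :
    ‖(((n !⁻¹ : ℂ)) • (s • M) ^ n) i j‖ ≤ (‖s‖ * h) ^ n / n ! := by
  have hh : 0 ≤ h := by
    haveI : Nonempty ι := ⟨i⟩
    exact hM.h_nonneg
  rw [expTerm_apply, norm_mul, norm_mul, norm_inv, Complex.norm_natCast, norm_pow, mul_pow,
    div_eq_inv_mul, mul_assoc]
  refine mul_le_mul_of_nonneg_left ?_ (inv_nonneg.2 (Nat.cast_nonneg _))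
  exact mul_le_mul_of_nonneg_left (hM.norm_pow_apply_le n i j) (pow_nonneg (norm_nonneg _) n)

/-- The tail of the exponential series: `Σ_{n ≥ d} xⁿ/n! ≤ (x^d/d!) eˣ` for `x ≥ 0`, in `HasSum`
form for the shifted majorant. [folklore] -/
theorem hasSum_shifted_expMajorant {x : ℝ} (d : ℕ) :
    HasSum (fun m : ℕ => x ^ d / d ! * (x ^ m / m !)) (x ^ d / d ! * Real.exp x) := by
  have h := NormedSpace.expSeries_div_hasSum_exp x
  rw [congr_fun Real.exp_eq_exp_ℝ x]
  exact h.mul_left _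

/-- `xⁿ/n! ≤ (x^d/d!) · (x^{n-d}/(n-d)!)` for `d ≤ n` and `x ≥ 0` (`d!(n-d)! ≤ n!`). [folklore] -/
theorem pow_div_factorial_le_mul {x : ℝ} (hx : 0 ≤ x) {d n : ℕ} (hdn : d ≤ n) :
    x ^ n / n ! ≤ x ^ d / d ! * (x ^ (n - d) / (n - d)!) := by
  rw [div_mul_div_comm, ← pow_add, Nat.add_sub_cancel' hdn]
  have hfac : ((d ! * (n - d)! : ℕ) : ℝ) ≤ (n ! : ℝ) := by
    have hdvd := Nat.factorial_mul_factorial_dvd_factorial_add d (n - d)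
    rw [Nat.add_sub_cancel' hdn] at hdvd
    exact_mod_cast Nat.le_of_dvd (Nat.factorial_pos n) hdvd
  rw [Nat.cast_mul] at hfac
  exact div_le_div_of_nonneg_left (pow_nonneg hx n) (by positivity) hfac

/-- **Locality of the matrix exponential of a hopping matrix**:
`‖(e^{sM}) i j‖ ≤ e^{‖s‖h} (‖s‖h)^{dist i j}/(dist i j)!` — the entries decay super-exponentially in
the distance, with constants depending on `‖s‖h` only (for a nearest-neighbour one-body
Hamiltonian on a torus: uniformly in the volume). The exponential series converges absolutely;
its terms of order `< dist i j` vanish at `(i,j)` and the others are `≤ (‖s‖h)ⁿ/n!`. [folklore] -/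
theorem _root_.Literature.Barriers.QuantumFields.HoppingExpansion.IsHoppingMatrix.norm_exp_smul_apply_le
    (hM : IsHoppingMatrix dist M h) (s : ℂ) (i j : ι) :
    ‖(exp (s • M)) i j‖ ≤
      Real.exp (‖s‖ * h) * ((‖s‖ * h) ^ dist i j / (dist i j)!) := by
  set d := dist i j with hd
  set x := ‖s‖ * h with hx
  have hh : 0 ≤ h := by
    haveI : Nonempty ι := ⟨i⟩
    exact hM.h_nonneg
  have hx0 : 0 ≤ x := mul_nonneg (norm_nonneg _) hh
  -- the exponential series, entrywise
  have hser := NormedSpace.exp_series_hasSum_exp' (𝕂 := ℂ) (s • M)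
  have hij : HasSum (fun n : ℕ => (((n !⁻¹ : ℂ)) • (s • M) ^ n) i j) ((exp (s • M)) i j) :=
    Pi.hasSum.1 (Pi.hasSum.1 hser i) j
  -- the majorant: `0` below the distance, `(x^d/d!) x^{n-d}/(n-d)!` above
  set g : ℕ → ℝ := fun n => if d ≤ n then x ^ d / d ! * (x ^ (n - d) / (n - d)!) else 0 with hg
  have hgsum : HasSum g (x ^ d / d ! * Real.exp x) := by
    rw [← hasSum_nat_add_iff' d]
    have h0 : ∑ i ∈ Finset.range d, g i = 0 :=
      Finset.sum_eq_zero fun n hn => by simp [hg, not_le.2 (Finset.mem_range.1 hn)]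
    rw [h0, sub_zero]
    refine (hasSum_shifted_expMajorant (x := x) d).congr_fun fun m => ?_
    simp [hg]
  have hle : ∀ n, ‖(((n !⁻¹ : ℂ)) • (s • M) ^ n) i j‖ ≤ g n := by
    intro n
    by_cases hdn : d ≤ n
    · simp only [hg, hdn, if_true]
      exact (hM.norm_expTerm_apply_le s n i j).trans (pow_div_factorial_le_mul hx0 hdn)
    · simp only [hg, hdn, if_false]
      rw [hM.expTerm_apply_eq_zero s (not_le.1 hdn), norm_zero]
  rw [← hij.tsum_eq, mul_comm (Real.exp x)]
  exact tsum_of_norm_bounded hgsum hle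

end Generic

/-! ### The Hubbard torus: locality of the imaginary-time one-body evolution, uniformly in `L` -/

section HubbardTorus

open Literature.Probability.LatticeModels

variable {d L : ℕ}

/-- The distance between two orbitals of the fermionic torus: the periodic `ℓ^∞` distance
(`torusDist`) of their sites (spins ignored). [folklore] -/
def orbTorusDist (o o' : Orb (FermionTorus d L)) : ℕ :=
  torusDist (FermionTorus.toTorusSite (ofLex o).1) (FermionTorus.toTorusSite (ofLex o').1)

/-- `orbTorusDist o o = 0`. [folklore] -/
@[simp] theorem orbTorusDist_self (o : Orb (FermionTorus d L)) : orbTorusDist o o = 0 := by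
  simp [orbTorusDist]

/-- Triangle inequality for `orbTorusDist` (`L ≠ 0`). [folklore] -/
theorem orbTorusDist_triangle [NeZero L] (o o' o'' : Orb (FermionTorus d L)) :
    orbTorusDist o o'' ≤ orbTorusDist o o' + orbTorusDist o' o'' :=
  torusDist_triangle' _ _ _

/-- Orbitals coupled by the one-body matrix are at distance `≤ 1`. [folklore] -/
theorem orbTorusDist_le_one_of_ne_zero [NeZero L] (t μ : ℝ) (o o' : Orb (FermionTorus d L))
    (h : hubbardOneBody (fermionTorusGraph d L) t μ o o' ≠ 0) : orbTorusDist o o' ≤ 1 := by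
  rw [hubbardOneBody_apply] at h
  by_cases hadj : (fermionTorusGraph d L).Adj (ofLex o).1 (ofLex o').1
  · exact torusDist_le_one_of_adj ((fermionTorusGraph_adj _ _).1 hadj)
  · by_cases hoo : o = o'
    · subst hoo; simp
    · exfalso
      apply h
      rw [if_neg (fun hh => hadj hh.1), if_neg hoo, sub_zero]

/-- **Row sums of the torus one-body matrix**: `Σ_{o'} |h_L(o,o')| ≤ 2d|t| + |μ|` for every `L`
(at most `2d` neighbours, `SourceGas.card_filter_fermionTorusGraph_adj_le`). [folklore] -/
theorem rowSum_hubbardOneBody_torus_le [NeZero L] (t μ : ℝ) (o : Orb (FermionTorus d L)) :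
    ∑ o', ‖hubbardOneBody (fermionTorusGraph d L) t μ o o'‖ ≤ 2 * d * |t| + |μ| := by
  classical
  set G := fermionTorusGraph d L with hG
  have hsplit : ∀ o' : Orb (FermionTorus d L), ‖hubbardOneBody G t μ o o'‖ ≤
      (if G.Adj (ofLex o).1 (ofLex o').1 ∧ (ofLex o).2 = (ofLex o').2 then |t| else 0) +
        (if o = o' then |μ| else 0) := by
    intro o'
    rw [hubbardOneBody_apply]
    refine (norm_sub_le _ _).trans (add_le_add ?_ ?_)
    · split_ifs <;> simp
    · split_ifs <;> simp
  refine (Finset.sum_le_sum fun o' _ => hsplit o').trans ?_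
  rw [Finset.sum_add_distrib, Finset.sum_ite_eq Finset.univ o, if_pos (Finset.mem_univ _),
    ← Finset.sum_filter, Finset.sum_const, nsmul_eq_mul]
  refine add_le_add ?_ le_rfl
  -- the same-spin neighbours inject into the neighbours of the site
  have hcard : (Finset.univ.filter fun o' : Orb (FermionTorus d L) =>
      G.Adj (ofLex o).1 (ofLex o').1 ∧ (ofLex o).2 = (ofLex o').2).card ≤
        (Finset.univ.filter (G.Adj (ofLex o).1)).card := by
    refine Finset.card_le_card_of_injOn (fun o' => (ofLex o').1) (fun o' ho' => ?_) ?_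
    · rw [Finset.mem_coe, Finset.mem_filter] at ho'
      rw [Finset.mem_coe, Finset.mem_filter]
      exact ⟨Finset.mem_univ _, ho'.2.1⟩
    · intro o₁ h₁ o₂ h₂ h12
      rw [Finset.mem_coe, Finset.mem_filter] at h₁ h₂
      have hs : (ofLex o₁).2 = (ofLex o₂).2 := h₁.2.2.symm.trans h₂.2.2
      have : ofLex o₁ = ofLex o₂ := Prod.ext h12 hs
      exact ofLex.injective this
  have hdeg := SourceGas.card_filter_fermionTorusGraph_adj_le (d := d) (L := L) (ofLex o).1
  calc ((Finset.univ.filter fun o' : Orb (FermionTorus d L) =>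
        G.Adj (ofLex o).1 (ofLex o').1 ∧ (ofLex o).2 = (ofLex o').2).card : ℝ) * |t|
      ≤ (2 * d : ℕ) * |t| := by
        refine mul_le_mul_of_nonneg_right ?_ (abs_nonneg t)
        exact_mod_cast hcard.trans hdeg
    _ = 2 * d * |t| := by push_cast; ring

/-- **The torus one-body matrix is a hopping matrix, uniformly in the side**: range `≤ 1` for
`orbTorusDist`, row sums `≤ 2d|t| + |μ|`. [folklore] -/
theorem isHoppingMatrix_hubbardOneBody_torus [NeZero L] (t μ : ℝ) :
    IsHoppingMatrix orbTorusDist (hubbardOneBody (fermionTorusGraph d L) t μ) (2 * d * |t| + |μ|) where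
  dist_self := orbTorusDist_self
  dist_triangle := orbTorusDist_triangle
  range_le_one := orbTorusDist_le_one_of_ne_zero t μ
  rowSum_le := rowSum_hubbardOneBody_torus_le t μ

/-- **Locality of the imaginary-time free evolution on the Hubbard torus, uniformly in `L`**:
`|[e^{s h_L}]_{(z,σ),(z',σ')}| ≤ e^{‖s‖K} (‖s‖K)^{dist(z,z')}/dist(z,z')!`, `K = 2d|t| + |μ|`,
`dist` the periodic `ℓ^∞` distance — for every side `L ≠ 0`, every complex `s` (e.g. `s ∈ [-β, β]`
for the propagators `e^{-τh}(1+e^{±βh})⁻¹` of BGM (1.4)). [folklore] -/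
theorem norm_exp_smul_hubbardOneBody_torus_apply_le [NeZero L] (t μ : ℝ) (s : ℂ)
    (o o' : Orb (FermionTorus d L)) :
    ‖(exp (s • hubbardOneBody (fermionTorusGraph d L) t μ)) o o'‖ ≤
      Real.exp (‖s‖ * (2 * d * |t| + |μ|)) *
        ((‖s‖ * (2 * d * |t| + |μ|)) ^ orbTorusDist o o' / (orbTorusDist o o')!) :=
  (isHoppingMatrix_hubbardOneBody_torus t μ).norm_exp_smul_apply_le s o o'

end HubbardTorus

end Literature.MathematicalPhysics.QuantumLattice
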